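import Summits.Ventures.PercRepro.ProfilePointedTriangleIdentity

/-!
# PercRepro — THE FLAT-CONTAINMENT MATCHING (FSUP): THE SURVIVOR OF (SUP), AND ITS BRIDGE TO (SYM) AND (C1′)
(p10, gen 18; `proofs/P10-AVFULL.md` §26(b))

For a finite matroid `M` on `N = #E` elements, a point `p` and the captured levels `𝒦_k = capLevel M p k`, say that
`X' ∈ 𝒦_{N−k}` DOMINATES `X ∈ 𝒦_k` in the FLAT order (`FlatLE M X X'`) when `cl X ⊆ cl X'` and
`cl (E ∖ X') ⊆ cl (E ∖ X)` (closures in `M`; the complements contain `p`).  Set containment `X ⊆ X'` implies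
`FlatLE` (`flatLE_of_subset`), so the containment matching (SUP) (`CapSup`, REFUTED at `n = 9`: 180 level instances,
`M(K_{2,4} + hub edge)`) is a special case of

  (FSUP) (`CapFlatSup`, NOT asserted): for every `2k < N` there is an injection `𝒦_k → 𝒦_{N−k}` along `FlatLE`.

(FSUP) ⟹ (SYM) `κ_k ≤ κ_{N−k}` (`capSym_of_capFlatSup`) ⟹ (C1′) (`capLimit_of_capFlatSup`), and (SUP) ⟹ (FSUP)
(`capFlatSup_of_capSup`).  Census (gen 18, own code; kit j277167): the flat-containment bipartite graph
`𝒦_k → 𝒦_{N−k}` has a matching saturating `𝒦_k` on ALL 1,713,027 level instances of the `n = 9` catalogue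
(where (SUP) fails 180 times), on all 30 / 39 / 574 / 1,285 level instances at `n = 5..8`, and on the (SUP) witness
itself (12 / 12 against 8 / 12).  The variant with the closures of the `p`-free complements fails at `n = 9`
(60 level instances), so the complements are taken in `E`, with `p`.  Nothing here asserts (FSUP), (SYM) or (C1′).
-/

open scoped Matroid

namespace PercRepro.Cogirth

open Finset ThmH Skew

variable {α : Type} [DecidableEq α] {M : Matroid α} [M.Finite]

/-- The flat order on `p`-avoiding sets: `cl X ⊆ cl X'` and `cl (E ∖ X') ⊆ cl (E ∖ X)`. -/
def FlatLE (M : Matroid α) [M.Finite] (X X' : Finset α) : Prop :=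
  clF M X ⊆ clF M X' ∧ clF M (gr M \ X') ⊆ clF M (gr M \ X)

/-- Set containment implies flat containment. -/
theorem flatLE_of_subset {X X' : Finset α} (h : X ⊆ X') : FlatLE M X X' :=
  ⟨fun _ hx => mem_clF_of_subset h hx,
    fun _ hx => mem_clF_of_subset (sdiff_subset_sdiff (Subset.refl _) h) hx⟩

/-- The flat order is reflexive. -/
theorem flatLE_refl (X : Finset α) : FlatLE M X X := ⟨Subset.refl _, Subset.refl _⟩

/-- The flat order is transitive. -/
theorem flatLE_trans {X Y Z : Finset α} (h1 : FlatLE M X Y) (h2 : FlatLE M Y Z) : FlatLE M X Z :=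
  ⟨h1.1.trans h2.1, h2.2.trans h1.2⟩

/-- **(FSUP) (NOT asserted)**: for every finite matroid on `α`, every point `p` and every level `2k < N`, there is an
injection `𝒦_k → 𝒦_{N−k}` along the flat order. -/
def CapFlatSup (α : Type) [DecidableEq α] : Prop :=
  ∀ (M : Matroid α) [M.Finite] (p : α) (k : ℕ), p ∈ gr M → 2 * k < (gr M).card →
    ∃ f : Finset α → Finset α, Set.InjOn f (capLevel M p k) ∧
      ∀ X ∈ capLevel M p k, f X ∈ capLevel M p ((gr M).card - k) ∧ FlatLE M X (f X)

open scoped Classical in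
/-- The Hall form of (FSUP) (NOT asserted): every family `𝒜 ⊆ 𝒦_k` has at least `#𝒜` flat-dominating sets in
`𝒦_{N−k}`. -/
def CapFlatSupHall (α : Type) [DecidableEq α] : Prop :=
  ∀ (M : Matroid α) [M.Finite] (p : α) (k : ℕ), p ∈ gr M → 2 * k < (gr M).card →
    ∀ 𝒜 : Finset (Finset α), 𝒜 ⊆ capLevel M p k →
      𝒜.card ≤ ((capLevel M p ((gr M).card - k)).filter (fun X' => ∃ X ∈ 𝒜, FlatLE M X X')).card

/-- (SUP) ⟹ (FSUP): the containment injection is a flat-order injection. -/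
theorem capFlatSup_of_capSup (h : CapSup α) : CapFlatSup α := by
  intro M _ p k hp hk
  obtain ⟨f, hinj, hf⟩ := h M p k hp hk
  exact ⟨f, hinj, fun X hX => ⟨(hf X hX).1, flatLE_of_subset (hf X hX).2⟩⟩

/-- (FSUP) ⟹ (SYM): the injection `𝒦_k → 𝒦_{N−k}` gives `κ_k ≤ κ_{N−k}`. -/
theorem capSym_of_capFlatSup (h : CapFlatSup α) : CapSym α := by
  intro M _ p k hp hk
  obtain ⟨f, hinj, hf⟩ := h M p k hp hk
  rw [← card_capLevel, ← card_capLevel]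
  exact card_le_card_of_injOn f (fun X hX => (hf X hX).1) hinj

/-- (FSUP) ⟹ (C1′), through (SYM). -/
theorem capLimit_of_capFlatSup (h : CapFlatSup α) : CapLimit α :=
  capLimit_of_capSym (capSym_of_capFlatSup h)

open scoped Classical in
/-- The injection form of (FSUP) gives its Hall form. -/
theorem capFlatSupHall_of_capFlatSup (h : CapFlatSup α) : CapFlatSupHall α := by
  intro M _ p k hp hk 𝒜 h𝒜
  obtain ⟨f, hinj, hf⟩ := h M p k hp hk
  apply card_le_card_of_injOn f
  · intro X hX
    have hX' : X ∈ 𝒜 := hX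
    have hXk : X ∈ capLevel M p k := h𝒜 hX'
    rw [mem_coe, mem_filter]
    exact ⟨(hf X hXk).1, X, hX', (hf X hXk).2⟩
  · exact hinj.mono (fun X hX => h𝒜 hX)

/-- A set dominating a captured set in the flat order captures `p` as well. -/
theorem mem_clF_of_flatLE {p : α} {X X' : Finset α} (hX : X ∈ capSets M p) (h : FlatLE M X X') :
    p ∈ clF M X' :=
  h.1 (mem_capSets.1 hX).2

end PercRepro.Cogirth
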